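import Summits.CriticalPhenomena.PercolationContinuityZ3.Theorems.Transplant.PlanarCellsSep
import Summits.CriticalPhenomena.PercolationContinuityZ3.Theorems.Transplant.PlanarCellsPSep3
import HarnessLib

/-!
# Kozma–Nitzan's planar cells in `ℤ²`, NARROW VARIANT (ruling (A2) of the general-node design, `HOME/SHEAR-SCOPE.md` §p3 3.0 item 3,
# §3.9 Layer 1): the between-box `Btw`, the far region `E^far`, `E_{v,x}` and the fresh rows `farA` with transverse half-width `5r − 1`
# instead of `5r` — definitions, containments, disjointness, self-adjacency, levels, planar bounds

builds on p205010 (kernel theorem, internal audit signed; external expert review pending) — nothing in this file uses p205010.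
Lane `prim-bschramm`, typed by the `prim-hp-8` lineage (gen 22) on the lead's assignment 2026-08-20T17:50:22Z; helper file
(`--supports stmt-CriticalPhenomena-4575 --as helper`).  NEW FILE: the frozen `PlanarCells{Defs,Sep,Faces,PSep2,PSep3,SepQ}` (cone of the
closed product node p228654) are imported, not edited; every unchanged object (`Q`, `M`, `Cell`, `Stub`, `Zone`, `Face`, `Hfull`, `lev`, `cen`)
and every lemma about them is used verbatim.

WHY.  The generic separation lift of a planar skeleton (`PlanarSkeleton.ne_not_adj_of_sepInf`, file `PlanarSkeletonPrisms`) forbids a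
`G`-edge between two windows as soon as their planar footprints are at ℓ^∞-distance `≥ 2` (`PlanarSkeleton.lip`: an edge moves the
skeleton coordinate by `≤ 1` in EACH coordinate — diagonal moves allowed, e.g. the fcc skeleton).  Of Kozma–Nitzan's no-edge separations
exactly one is tight at ℓ^∞-distance `1`: the sibling between-box `Btw v δ'` against `E^far_{v,δ}`, `δ' ⊥ δ` (corners `cen v + (5r+1, 5r)` /
`cen v + (5r, 5r+1)`, `PlanarCellsPSep2.Btw_sep_Efar`).  Narrowing the TRANSVERSE half-width of `Btw` and `E^far` from `5r` to `5r − 1`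
gives that pair ℓ^∞-gap `2` and changes nothing else: stubs / zones / faces / corridors have transverse half-width `2r`, `M` has `3r`,
`Q` keeps `5r` (so `E^far ⊆ Btw ∪ Q_{v+δ}` survives with equal widths), and every other separation has gap `≥ min (5r, 10s) ≥ 10`.
k1 audit (refuter's kill list, SHEAR-SCOPE §p5 item 7): the only zero-slack customers of the old width `5r` are `Q_{v+δ} ⊆ E^far_{v,δ}`
(`PCells.mem_Efar_of_mem_Q_add`, FALSE for the narrow boxes — not provided; its one consumer, the sibling case of hSB, is re-proved directly in
`PlanarCellsNarrowSep`) and the fresh rows `farA` (narrowed here to `farAN`; `Face_enlarge_subset_farAN` needs only `k + 2 ≤ 10s`, and the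
inner run's transverse hypotheses of the (F) residue read `≤ 5r − 1`, discharged with slack `2r`).

* `BtwN v δ = cen v + {5r < σ x_a < 15r} × [-(5r-1), 5r-1]`, `EfarN v δ = cen v + {5r < σ x_a ≤ 25r} × [-(5r-1), 5r-1]`,
  `EwvN = BtwN ∪ Q_{v+δ}`, `farAN x du j = cen x + {5r + 10sj < σ x_a ≤ 25r} × [-(5r-1), 5r-1]`;
* `BtwN ⊆ Btw`, `EfarN ⊆ Efar`, `EwvN ⊆ Ewv`, `BtwN ⊆ EfarN`, `farAN ⊆ EfarN`;
* the containments of `SepGeom`/`StepsGeom` (planar halves): `BtwN_subset_Cells`, `Stub_subset_Q_union_BtwN`, `EfarN_subset_BtwN_union_Q`,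
  `Hfull_subset_Q_union_EfarN`, `M_add_stepVec_subset_EfarN`, `M_add_stepVec_subset_farAN`, `Face_enlarge_subset_farAN`;
* disjointness (all by monotonicity from `PlanarCellsSep`): `Q_disjoint_BtwN`, `Q_disjoint_EfarN`, `BtwN_disjoint_EfarN`, `EwvN_disjoint_EfarN`,
  `BtwN_disjoint_BtwN`, and `EfarN_disjoint_Q`, `farAN_disjoint_Q`, `farAN_disjoint_Stub`;
* `exists_adj_of_mem_BtwN` (planar self-adjacency), `BtwN_rev'`;
* levels: `lev_ge_of_mem_EfarN`, `lev_le_of_mem_Hfull_of_not_past_EfarN`, `mem_EfarN_of_mem_Hfull`, `mem_farAN_of_mem_Hfull`,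
  `lev_le_of_mem_Hfull_not_EfarN'`, `Face_far_EfarN'`;
* planar bounds: `sub_cen_le_of_mem_EwvN` (`35r`), `EfarN_subset_box_image`, `BtwN_subset_box_image_tgt` (`cen + Λ_{25r}`).

[cite: KozmaNitzan2024, §4 pp. 25–26 (Q_v, M_v, E_{v,x}, H^j_{v,x}), p. 30 (F^j_{v,x}, the rows above it), p. 31 ((31)) — the ℤ^d model]
-/

noncomputable section

namespace Summit.CriticalPhenomena.PercolationContinuityZ3.Theorems

namespace Transplant

open Literature.Probability.Percolation Literature.Probability.LatticeModels SimpleGraph GadgetSystem Contour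
open Literature.Probability.Percolation.KozmaNitzan
open Literature.Probability.Percolation.KozmaNitzan.Cells (oth oth_ne sgOf sgOf_sign stepVec_apply_fst stepVec_apply_oth eq_oth_of_ne oth_oth
  eq_of_coords)

namespace PCells

variable (C : PCells)

/-! ## The narrow boxes -/

/-- **The narrow between-box** `cen v + {5r < σ x_a < 15r} × [-(5r-1), 5r-1]` (KN's `E_{v,x} ∖ Q_x` with transverse half-width `5r − 1`).
[cite: KozmaNitzan2024, §4 p. 26 (E_{v,x})] -/
def BtwN (v : Site 2) (δ : MDir) : Finset (Site 2) := sBox δ.1 (sgOf δ) (C.cen v) (5 * C.r + 1) (15 * C.r - 1) (5 * C.r - 1)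

/-- **The narrow far region** `cen v + {5r < σ x_a ≤ 25r} × [-(5r-1), 5r-1]`. [cite: KozmaNitzan2024, §4 p. 26 (E_{v,x})] -/
def EfarN (v : Site 2) (δ : MDir) : Finset (Site 2) := sBox δ.1 (sgOf δ) (C.cen v) (5 * C.r + 1) (25 * C.r) (5 * C.r - 1)

/-- **The narrow `E_{v,x} = BtwN ∪ Q_x`.** [cite: KozmaNitzan2024, §4 p. 26 (E_{v,x})] -/
def EwvN (v : Site 2) (δ : MDir) : Finset (Site 2) := C.BtwN v δ ∪ C.Q (v + stepVec δ)

/-- **The narrow fresh rows above the stub of level `j`**: `cen x + {5r + 10 s j + 1 ≤ level ≤ 25 r} × [-(5r-1), 5r-1]`.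
[cite: KozmaNitzan2024, §4 p. 30] -/
def farAN (x : Site 2) (du : MDir) (j : ℕ) : Finset (Site 2) :=
  sBox du.1 (sgOf du) (C.cen x) (5 * C.r + 10 * C.s * j + 1) (25 * C.r) (5 * C.r - 1)

/-! ## Comparison with the wide boxes -/

/-- `BtwN ⊆ Btw`. [folklore] -/
theorem BtwN_subset_Btw (v : Site 2) (δ : MDir) : C.BtwN v δ ⊆ C.Btw v δ :=
  sBox_mono (sgOf_sign δ) _ le_rfl le_rfl (by omega)

/-- `EfarN ⊆ Efar`. [folklore] -/
theorem EfarN_subset_Efar (v : Site 2) (δ : MDir) : C.EfarN v δ ⊆ C.Efar v δ :=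
  sBox_mono (sgOf_sign δ) _ le_rfl le_rfl (by omega)

/-- `EwvN ⊆ Ewv`. [folklore] -/
theorem EwvN_subset_Ewv (v : Site 2) (δ : MDir) : C.EwvN v δ ⊆ C.Ewv v δ :=
  Finset.union_subset_union (C.BtwN_subset_Btw v δ) le_rfl

/-- `BtwN ⊆ EfarN`. [folklore] -/
theorem BtwN_subset_EfarN (v : Site 2) (δ : MDir) : C.BtwN v δ ⊆ C.EfarN v δ :=
  sBox_mono (sgOf_sign δ) _ le_rfl (by have := C.one_le_r; omega) le_rfl

/-- `farAN ⊆ EfarN`. [folklore] -/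
theorem farAN_subset_EfarN (x : Site 2) (du : MDir) (j : ℕ) : C.farAN x du j ⊆ C.EfarN x du := by
  refine sBox_mono (sgOf_sign du) _ ?_ le_rfl le_rfl
  nlinarith [C.hs, Nat.zero_le j]

/-- `BtwN ⊆ Efar` (note: `Q_{v+δ} ⊆ EfarN` FAILS transversally, so there is no narrow twin of `mem_Efar_of_mem_Q_add`). [folklore] -/
theorem BtwN_subset_Efar (v : Site 2) (δ : MDir) : C.BtwN v δ ⊆ C.Efar v δ :=
  (C.BtwN_subset_EfarN v δ).trans (C.EfarN_subset_Efar v δ)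

/-! ## Containments -/

/-- `BtwN_{v,δ} ⊆ Cell_v ∪ Cell_{v+δ}`. [folklore] -/
theorem BtwN_subset_Cells (v : Site 2) (δ : MDir) : C.BtwN v δ ⊆ C.Cell v ∪ C.Cell (v + stepVec δ) :=
  (C.BtwN_subset_Btw v δ).trans (C.Btw_subset_Cells v δ)

/-- `H^j ⊆ Q_v ∪ BtwN` for `j + 1 ≤ K` (the stub has transverse half-width `2r ≤ 5r − 1`). [folklore] -/
theorem Stub_subset_Q_union_BtwN (v : Site 2) (δ : MDir) {j : ℕ} (hj : j < C.K) : (C.Stub v δ j : Finset (Site 2)) ⊆ C.Q v ∪ C.BtwN v δ := by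
  intro t ht
  rw [Stub, mem_psBox_iff] at ht
  obtain ⟨⟨h1, h2⟩, h3, h4⟩ := ht
  have hsj : 10 * (C.s : ℤ) * j ≤ 10 * C.r - 10 * C.s := by
    have : C.s * (j + 1) ≤ C.s * C.K := Nat.mul_le_mul_left _ (by omega)
    have hr : (C.r : ℤ) = C.K * C.s := by simp [r]
    nlinarith
  have hs1 := C.hs
  have hr1 := C.one_le_r
  rw [Finset.mem_union, Q, C.mem_sq_iff, BtwN, mem_psBox_iff]
  by_cases hlev : sgOf δ * (t δ.1 - C.cen v δ.1) ≤ 5 * C.r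
  · left
    intro i
    rcases eq_or_ne i δ.1 with rfl | hi
    · rcases sgOf_sign δ with hs | hs <;> rw [hs] at h1 hlev <;> push_cast <;> constructor <;> omega
    · rw [eq_oth_of_ne hi]; push_cast; constructor <;> omega
  · right
    refine ⟨⟨by omega, by omega⟩, by omega, by omega⟩

/-- `EfarN ⊆ BtwN ∪ Q_{v+δ}` (equal transverse widths below level `15r`; `Q_{v+δ}` is wider above). [folklore] -/
theorem EfarN_subset_BtwN_union_Q (v : Site 2) (δ : MDir) : (C.EfarN v δ : Finset (Site 2)) ⊆ C.BtwN v δ ∪ C.Q (v + stepVec δ) := by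
  intro t ht
  rw [EfarN, mem_psBox_iff] at ht
  obtain ⟨⟨h1, h2⟩, h3, h4⟩ := ht
  rw [Finset.mem_union, BtwN, mem_psBox_iff, Q, C.mem_sq_iff]
  by_cases hlev : sgOf δ * (t δ.1 - C.cen v δ.1) ≤ 15 * C.r - 1
  · left
    exact ⟨⟨by omega, by omega⟩, by omega, by omega⟩
  · right
    have hf := C.cen_add_stepVec_fst v δ
    have ho := C.cen_add_stepVec_oth v δ
    intro i
    rcases eq_or_ne i δ.1 with rfl | hi
    · rw [hf]
      rcases sgOf_sign δ with hs | hs <;> rw [hs] at h2 hlev ⊢ <;> push_cast at h2 ⊢ <;> constructor <;> omega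
    · rw [eq_oth_of_ne hi, ho]; push_cast at h3 h4 ⊢; constructor <;> omega

/-- The full corridor lies in `Q_v ∪ EfarN_{v,x}` (corridor half-width `2r ≤ 5r − 1`). [folklore] -/
theorem Hfull_subset_Q_union_EfarN (v : Site 2) (δ : MDir) : (C.Hfull v δ : Finset (Site 2)) ⊆ C.Q v ∪ C.EfarN v δ := by
  intro t ht
  rw [Hfull, mem_psBox_iff] at ht
  obtain ⟨⟨h1, h2⟩, h3, h4⟩ := ht
  have hr1 := C.one_le_r
  rw [Finset.mem_union, Q, C.mem_sq_iff, EfarN, mem_psBox_iff]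
  by_cases hlev : sgOf δ * (t δ.1 - C.cen v δ.1) ≤ 5 * C.r
  · left
    intro i
    rcases eq_or_ne i δ.1 with rfl | hi
    · rcases sgOf_sign δ with hs | hs <;> rw [hs] at h1 hlev <;> push_cast <;> constructor <;> omega
    · rw [eq_oth_of_ne hi]; push_cast; constructor <;> omega
  · right
    exact ⟨⟨by omega, by omega⟩, by omega, by omega⟩

/-- The target cube lies in the narrow far region: `M_{v+δ} ⊆ EfarN_{v,δ}` (`3r ≤ 5r − 1`). [folklore] -/
theorem M_add_stepVec_subset_EfarN (v : Site 2) (δ : MDir) : (C.M (v + stepVec δ) : Finset (Site 2)) ⊆ C.EfarN v δ := by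
  intro t ht
  rw [M, C.mem_sq_iff] at ht
  rw [EfarN, mem_psBox_iff]
  have hf := C.cen_add_stepVec_fst v δ
  have ho := C.cen_add_stepVec_oth v δ
  have ha := ht δ.1
  have hb := ht (oth δ.1)
  rw [hf] at ha
  rw [ho] at hb
  push_cast at ha hb
  have hr : (1 : ℤ) ≤ C.r := by exact_mod_cast C.one_le_r
  refine ⟨?_, by omega, by omega⟩
  rcases sgOf_sign δ with hs | hs <;> rw [hs] at ha ⊢ <;> constructor <;> omega

/-- **`M(x + du) ⊆ farAN`** for `j ≤ K` (the middle box of the neighbour lies at levels `17r … 23r`, transversally within `3r ≤ 5r − 1`).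
[cite: KozmaNitzan2024, §4 p. 26] -/
theorem M_add_stepVec_subset_farAN (x : Site 2) (du : MDir) {j : ℕ} (hj : j ≤ C.K) : C.M (x + stepVec du) ⊆ C.farAN x du j := by
  intro t ht
  rw [M, C.mem_sq_iff] at ht
  rw [farAN, mem_psBox_iff]
  have h1 := ht du.1
  have h2 := ht (oth du.1)
  rw [C.cen_add_stepVec_fst] at h1
  rw [C.cen_add_stepVec_oth] at h2
  have hsj : 10 * (C.s : ℤ) * j ≤ 10 * C.r := by
    have : (C.s : ℤ) * j ≤ C.r := by
      have h := Nat.mul_le_mul_left C.s hj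
      rw [Nat.mul_comm C.s C.K] at h
      exact_mod_cast (show C.s * j ≤ C.r from h)
    linarith
  push_cast at h1 h2 ⊢
  refine ⟨?_, by constructor <;> linarith [h2.1, h2.2, C.one_le_r]⟩
  rcases sgOf_sign du with hs | hs <;> rw [hs] at h1 ⊢ <;> constructor <;> nlinarith [h1.1, h1.2, C.one_le_r]

/-- **The `k`-enlargement of the face row `F^{j+1}` lies in `farAN`** when `k + 2 ≤ 10 s` and `j + 1 ≤ K` (transversally `2r + k ≤ 5r − 1`
because `k ≤ 10s − 2 ≤ r/2 − 2`; the wide version's extra hypothesis `k ≤ 3r` was idle). [cite: KozmaNitzan2024, §4 p. 30 (the levels above F^{j+1})] -/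
theorem Face_enlarge_subset_farAN (x : Site 2) (du : MDir) {j k : ℕ} (hj : j + 1 ≤ C.K) (hk : k + 2 ≤ 10 * C.s) :
    Finset.Icc (sLo du.1 (sgOf du) (C.cen x) (5 * C.r + 10 * C.s * (j + 1 : ℕ)) (5 * C.r + 10 * C.s * (j + 1 : ℕ)) (2 * C.r) - (k : Site 2))
      (sHi du.1 (sgOf du) (C.cen x) (5 * C.r + 10 * C.s * (j + 1 : ℕ)) (5 * C.r + 10 * C.s * (j + 1 : ℕ)) (2 * C.r) + (k : Site 2)) ⊆
      C.farAN x du j := by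
  rw [sBox_enlarge _ _ (sgOf_sign du), farAN]
  have hsj : (C.s : ℤ) * (j + 1) ≤ C.r := by
    have h := Nat.mul_le_mul_left C.s hj
    rw [Nat.mul_comm C.s C.K] at h
    exact_mod_cast (show C.s * (j + 1) ≤ C.r from h)
  have h20 := C.twenty_mul_s_le_r
  refine sBox_mono (sgOf_sign du) _ ?_ ?_ ?_ <;> push_cast <;> nlinarith [C.one_le_r, C.hs]

/-! ## Disjointness (inherited from the wide boxes) -/

/-- Cubes and narrow between-boxes are disjoint. [folklore] -/
theorem Q_disjoint_BtwN (x v : Site 2) (δ : MDir) : Disjoint (C.Q x : Finset (Site 2)) (C.BtwN v δ) :=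
  (C.Q_disjoint_Btw x v δ).mono le_rfl (C.BtwN_subset_Btw v δ)

/-- A cube misses the narrow far region of its own macro-vertex. [folklore] -/
theorem Q_disjoint_EfarN (v : Site 2) (δ : MDir) : Disjoint (C.Q v : Finset (Site 2)) (C.EfarN v δ) :=
  (C.Q_disjoint_Efar v δ).mono le_rfl (C.EfarN_subset_Efar v δ)

/-- `EfarN` misses the cube `Q x` (the same fact, stated from the far side). [folklore] -/
theorem EfarN_disjoint_Q (x : Site 2) (du : MDir) : Disjoint (C.EfarN x du) (C.Q x) :=
  (C.Q_disjoint_EfarN x du).symm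

/-- Narrow between-boxes of other directions at the same macro-vertex miss the narrow far region. [folklore] -/
theorem BtwN_disjoint_EfarN (v : Site 2) {δ δ' : MDir} (h : δ' ≠ δ) : Disjoint (C.BtwN v δ') (C.EfarN v δ) :=
  (C.Btw_disjoint_Efar v h).mono (C.BtwN_subset_Btw v δ') (C.EfarN_subset_Efar v δ)

/-- `EwvN_{w,δw}` misses the narrow far regions of `w + δw` in every direction except back. [folklore] -/
theorem EwvN_disjoint_EfarN (w : Site 2) {δw du : MDir} (h : du ≠ rev δw) :
    Disjoint (C.EwvN w δw) (C.EfarN (w + stepVec δw) du) :=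
  (C.Ewv_disjoint_Efar w h).mono (C.EwvN_subset_Ewv w δw) (C.EfarN_subset_Efar _ du)

/-- Narrow between-boxes of different (undirected) macro-edges are disjoint. [folklore] -/
theorem BtwN_disjoint_BtwN {v v' : Site 2} {δ δ' : MDir} (h1 : (v', δ') ≠ (v, δ)) (h2 : (v', δ') ≠ (v + stepVec δ, rev δ)) :
    Disjoint (C.BtwN v δ : Finset (Site 2)) (C.BtwN v' δ') :=
  (C.Btw_disjoint_Btw h1 h2).mono (C.BtwN_subset_Btw v δ) (C.BtwN_subset_Btw v' δ')

/-- `farAN` misses the stub of level `j`. [folklore] -/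
theorem farAN_disjoint_Stub (x : Site 2) (du : MDir) (j : ℕ) : Disjoint (C.farAN x du j) (C.Stub x du j) := by
  rw [Finset.disjoint_left]
  intro t ht ht'
  rw [farAN, mem_psBox_iff] at ht
  rw [Stub, mem_psBox_iff] at ht'
  omega

/-- `farAN` misses the cube `Q x`. [folklore] -/
theorem farAN_disjoint_Q (x : Site 2) (du : MDir) (j : ℕ) : Disjoint (C.farAN x du j) (C.Q x) :=
  (C.EfarN_disjoint_Q x du).mono (C.farAN_subset_EfarN x du j) le_rfl

/-! ## Self-adjacency and the reversed narrow between-box -/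

/-- Self-adjacency of `BtwN` (its transverse side has length `2(5r − 1) ≥ 1`). [folklore] -/
theorem exists_adj_of_mem_BtwN (v : Site 2) (δ : MDir) {t : Site 2} (ht : t ∈ C.BtwN v δ) : ∃ t' ∈ C.BtwN v δ, (zdGraph 2).Adj t t' := by
  unfold BtwN sBox at ht ⊢
  refine exists_adj_of_mem_Icc (oth δ.1) ?_ ht
  simp only [sLo, sHi, if_neg (oth_ne δ.1)]
  have := C.one_le_r; omega

/-- **The narrow between-box of a directed macro-edge equals that of the reversed edge.** [folklore] -/
theorem BtwN_rev' (v : Site 2) (δ : MDir) : (C.BtwN (v + stepVec δ) (rev δ) : Finset (Site 2)) = C.BtwN v δ := by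
  ext t
  have hax : (rev δ).1 = δ.1 := rfl
  rw [BtwN, BtwN, mem_psBox_iff, mem_psBox_iff, hax, Cells.sgOf_rev, C.cen_add_stepVec_fst, C.cen_add_stepVec_oth]
  rcases sgOf_sign δ with hs | hs <;> rw [hs] <;> constructor <;> rintro ⟨⟨h1, h2⟩, h3, h4⟩ <;>
    exact ⟨⟨by omega, by omega⟩, h3, h4⟩

/-! ## Levels -/

/-- Points of `EfarN_{v,δ}` have level at least `5r + 1`. [folklore] -/
theorem lev_ge_of_mem_EfarN {δ : MDir} {v t : Site 2} (ht : t ∈ C.EfarN v δ) : 5 * (C.r : ℤ) + 1 ≤ C.lev δ v t := by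
  rw [EfarN, mem_psBox_iff] at ht; exact ht.1.1

/-- A point of the corridor `H_{v,δ}` NOT of level `> L` inside `EfarN` has level `≤ L` (`5r ≤ L`). [folklore] -/
theorem lev_le_of_mem_Hfull_of_not_past_EfarN {δ : MDir} {v t : Site 2} (ht : t ∈ C.Hfull v δ) {L : ℤ} (hL : 5 * (C.r : ℤ) ≤ L)
    (hn : ¬(t ∈ C.EfarN v δ ∧ L + 1 ≤ C.lev δ v t)) : C.lev δ v t ≤ L := by
  by_contra hlt
  push Not at hlt
  apply hn
  rw [Hfull, mem_psBox_iff] at ht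
  refine ⟨?_, by omega⟩
  rw [EfarN, mem_psBox_iff]
  unfold lev at hlt
  have := C.one_le_r
  exact ⟨⟨by omega, by omega⟩, by omega, by omega⟩

/-- A corridor point of level `≥ 5r + 1` lies in the narrow far region (corridor half-width `2r ≤ 5r − 1`; membership form of the previous
lemma, convenient for shifted level data). [folklore] -/
theorem mem_EfarN_of_mem_Hfull {δ : MDir} {v t : Site 2} (ht : t ∈ C.Hfull v δ) (hl : 5 * (C.r : ℤ) + 1 ≤ C.lev δ v t) : t ∈ C.EfarN v δ := by
  rw [Hfull, mem_psBox_iff] at ht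
  rw [EfarN, mem_psBox_iff]
  unfold lev at hl
  have := C.one_le_r
  exact ⟨⟨hl, by omega⟩, by omega, by omega⟩

/-- A corridor point of level `≥ 5r + 10 s j + 1` lies in the narrow fresh rows `farAN x du j`. [folklore] -/
theorem mem_farAN_of_mem_Hfull {du : MDir} {x t : Site 2} (ht : t ∈ C.Hfull x du) {j : ℕ} (hl : 5 * (C.r : ℤ) + 10 * C.s * j + 1 ≤ C.lev du x t) :
    t ∈ C.farAN x du j := by
  rw [Hfull, mem_psBox_iff] at ht
  rw [farAN, mem_psBox_iff]
  unfold lev at hl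
  have := C.one_le_r
  exact ⟨⟨hl, by omega⟩, by omega, by omega⟩

/-- A corridor point off the narrow far region has level `≤ 5r`. [folklore] -/
theorem lev_le_of_mem_Hfull_not_EfarN' {δ : MDir} {v t : Site 2} (ht : t ∈ C.Hfull v δ) (hn : t ∉ C.EfarN v δ) :
    C.lev δ v t ≤ 5 * C.r :=
  C.lev_le_of_mem_Hfull_of_not_past_EfarN ht le_rfl fun h => hn h.1

/-- `F^{j+1}` lies in the narrow far region, beyond level `5r + 10sj` (`j + 1 ≤ K`). [folklore] -/
theorem Face_far_EfarN' {δ : MDir} {v t : Site 2} {j : ℕ} (hjK : j + 1 ≤ C.K) (ht : t ∈ C.Face v δ (j + 1)) :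
    t ∈ C.EfarN v δ ∧ 5 * (C.r : ℤ) + 10 * C.s * j + 1 ≤ C.lev δ v t := by
  rw [Face, mem_psBox_iff] at ht
  have hs1 : (1 : ℤ) ≤ C.s := by exact_mod_cast C.hs
  have hr1 : (1 : ℤ) ≤ C.r := by exact_mod_cast C.one_le_r
  have hrK : (C.r : ℤ) = C.K * C.s := by simp [PCells.r]
  have hjK' : (j : ℤ) + 1 ≤ C.K := by exact_mod_cast hjK
  have hb : 10 * (C.s : ℤ) * (j + 1) ≤ 10 * C.s * C.K := mul_le_mul_of_nonneg_left hjK' (by positivity)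
  push_cast at ht
  refine ⟨?_, by unfold lev; nlinarith [ht.1.1]⟩
  rw [EfarN, mem_psBox_iff]
  exact ⟨⟨by nlinarith [ht.1.1], by nlinarith [ht.1.2]⟩, by omega, by omega⟩

/-! ## Planar bounds -/

/-- A crude planar bound: a point of `EwvN_{w,δ}` is within `35 r` of the centre of `w + δ` in each coordinate. [folklore] -/
theorem sub_cen_le_of_mem_EwvN {w : Site 2} {δ : MDir} {t : Site 2} (ht : t ∈ C.EwvN w δ) (i : Fin 2) :
    |t i - C.cen (w + stepVec δ) i| ≤ 35 * C.r := by
  rw [EwvN, Finset.mem_union] at ht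
  have hf := C.cen_add_stepVec_fst w δ
  have ho := C.cen_add_stepVec_oth w δ
  have hr1 : (1 : ℤ) ≤ C.r := by exact_mod_cast C.one_le_r
  rw [abs_le]
  rcases ht with ht | ht
  · rw [BtwN, mem_psBox_iff] at ht
    obtain ⟨⟨h1, h2⟩, h3, h4⟩ := ht
    rcases eq_or_ne i δ.1 with rfl | hi
    · rw [hf]; rcases sgOf_sign δ with hs | hs <;> rw [hs] at h1 h2 ⊢ <;> constructor <;> nlinarith
    · rw [eq_oth_of_ne hi, ho]; constructor <;> linarith
  · rw [Q, C.mem_sq_iff] at ht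
    have := ht i; push_cast at this; constructor <;> linarith

/-- `EfarN(x, du) ⊆ cen x + Λ_{25 r}`. [folklore] -/
theorem EfarN_subset_box_image (x : Site 2) (du : MDir) : C.EfarN x du ⊆ (box 2 (25 * C.r)).image (fun s => s + C.cen x) := by
  intro t ht
  rw [EfarN, mem_psBox_iff] at ht
  refine Finset.mem_image.2 ⟨t - C.cen x, ?_, by abel⟩
  rw [mem_box]
  intro i
  simp only [Pi.sub_apply]
  push_cast
  by_cases hi : i = du.1
  · subst hi
    rcases sgOf_sign du with hs | hs <;> rw [hs] at ht <;> constructor <;> nlinarith [ht.1.1, ht.1.2, C.one_le_r]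
  · rw [eq_oth_of_ne hi]; constructor <;> linarith [ht.2.1, ht.2.2, C.one_le_r]

/-- `BtwN v δ ⊆ cen (v + δ) + Λ_{25 r}` (the narrow between-box seen from the target cell). [folklore] -/
theorem BtwN_subset_box_image_tgt (v : Site 2) (δ : MDir) :
    C.BtwN v δ ⊆ (box 2 (25 * C.r)).image (fun s => s + C.cen (v + stepVec δ)) := by
  intro t ht
  rw [BtwN, mem_psBox_iff] at ht
  refine Finset.mem_image.2 ⟨t - C.cen (v + stepVec δ), ?_, by abel⟩
  rw [mem_box]
  intro i
  simp only [Pi.sub_apply]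
  push_cast at ht ⊢
  by_cases hi : i = δ.1
  · subst hi
    rw [C.cen_add_stepVec_fst]
    rcases sgOf_sign δ with hs | hs <;> rw [hs] at ht ⊢ <;> constructor <;> nlinarith [ht.1.1, ht.1.2, C.one_le_r]
  · rw [eq_oth_of_ne hi, C.cen_add_stepVec_oth]; constructor <;> linarith [ht.2.1, ht.2.2, C.one_le_r]

/-- `farAN(x, du, j) ⊆ cen x + Λ_{25 r}`. [folklore] -/
theorem farAN_subset_box_image (x : Site 2) (du : MDir) (j : ℕ) : C.farAN x du j ⊆ (box 2 (25 * C.r)).image (fun s => s + C.cen x) :=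
  (C.farAN_subset_EfarN x du j).trans (C.EfarN_subset_box_image x du)

end PCells

end Transplant

end Summit.CriticalPhenomena.PercolationContinuityZ3.Theorems

end
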